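import Summits.KontsevichZagierPeriods.KontsevichZagierPeriods.Theses.TorsionLogs

/-!
# WITNESS (F3 / BC5) for the rung `NeronTorsionTwoPoint` — the floor IS the member `N' = 2`

`neronTorsionChainFrom_two : NeronTorsionChainFrom 2` (sorry-free) from the SEED
`Summit.KontsevichZagierPeriods.KontsevichZagierPeriods.Cruxes.NeronTorsionSector.Translation.stub_assembly`
(= `Theses.TorsionLogs.NeronTorsionPrimitiveChain_holds`, item stmt-KontsevichZagierPeriods-17981): at `N' = 2` the
sheet condition `0 < 2a' ≤ N'` forces `a' = 1`, the first-kind datum `2∫_{x_Q}^∞ dx/√f = ω₁` forces `x_Q = e₁`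
(the real dictionary `stub_realDictionary`: `u ↦ ∫_{X u}^∞ dx/√f` is the identity on `(0, ω₁/2]` and `X u > e₁` off
`ω₁/2`), the second-kind datum on the empty interval forces `ϱ = 0`, so `[rW] = [0] ∈ relations` and the element
is the floor's. Conversely `neronTorsionPrimitiveChain_of_two : NeronTorsionChainFrom 2 → NeronTorsionPrimitiveChain`
(the 2-torsion point `(e₁,0)` has order `2`; the zero representation on `{e₁ < t}` exists since `e₁` is algebraic,
`stub_parametersAlgebraic`), whence `neronTorsionChainFrom_two_iff`. Self-contained: verbatim copies of the two
`def`s of `Lines/NeronTorsionTwoPoint.lean` in the namespace `…NeronTorsionTwoPoint.Special`.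
-/

open Set MeasureTheory
open Literature.NumberTheory.Transcendental Literature.ModelTheory.ExponentialFields
open Summit.KontsevichZagierPeriods.KontsevichZagierPeriods.Cruxes.NeronTorsionSector.Translation
  (stub_assembly stub_realDictionary stub_parametersAlgebraic)

namespace Summit.KontsevichZagierPeriods.KontsevichZagierPeriods.Cruxes.TorsionSectorComplete.NeronTorsionTwoPoint.Special

/-- FAMILY (verbatim copy of `Lines/NeronTorsionTwoPoint.lean`). -/
def NeronTorsionChainFrom (N' : ℕ) : Prop :=
  ∀ (g₂ g₃ e₁ xP yP xQ yQ ϱ : ℝ) (N a a' p q : ℕ) (f : ℝ → ℝ),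
    (∀ x, f x = 4 * x ^ 3 - g₂ * x - g₃) → g₂ ^ 3 - 27 * g₃ ^ 2 ≠ 0 → f e₁ = 0 → 0 < e₁ →
    (∀ x, e₁ < x → 0 < f x) → e₁ < xP → yP ^ 2 = f xP → 3 ≤ N → 0 < a → 2 * a < N →
    (∀ hns : (⟨0, 0, 0, -g₂ / 4, -g₃ / 4⟩ : WeierstrassCurve ℝ).toAffine.Nonsingular xP (yP / 2),
      addOrderOf (WeierstrassCurve.Affine.Point.some xP (yP / 2) hns) = N) →
    (N : ℝ) * (∫ x in Set.Ioi xP, (Real.sqrt (f x))⁻¹) = a * (2 * ∫ x in Set.Ioi e₁, (Real.sqrt (f x))⁻¹) →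
    e₁ ≤ xQ → xQ < xP → yQ ^ 2 = f xQ → 2 ≤ N' → 0 < a' → 2 * a' ≤ N' →
    (∀ hns : (⟨0, 0, 0, -g₂ / 4, -g₃ / 4⟩ : WeierstrassCurve ℝ).toAffine.Nonsingular xQ (yQ / 2),
      addOrderOf (WeierstrassCurve.Affine.Point.some xQ (yQ / 2) hns) = N') →
    (N' : ℝ) * (∫ x in Set.Ioi xQ, (Real.sqrt (f x))⁻¹) = a' * (2 * ∫ x in Set.Ioi e₁, (Real.sqrt (f x))⁻¹) →
    (∫ x in Set.Ioo e₁ xQ, x / Real.sqrt (f x)) =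
      ϱ + ((a' : ℝ) / N' - 1 / 2) * ∫ x in Set.Ioi e₁, (g₂ * x + 2 * g₃) / (2 * x ^ 2 * Real.sqrt (f x)) →
    Nat.Coprime p q → (q : ℤ) * ((a' : ℤ) * N - (a : ℤ) * N') = (p : ℤ) * ((N : ℤ) * N') →
    ∀ (rI rP : Literature.NumberTheory.Transcendental.KZ.IntegralRep 2)
      (rW : Literature.NumberTheory.Transcendental.KZ.IntegralRep 1),
    rI.domain = {z | xQ < z 1 ∧ z 1 < z 0 ∧ z 0 < xP} →
    Set.EqOn rI.integrand (fun z => z 1 / (Real.sqrt (f (z 1)) * Real.sqrt (f (z 0)))) rI.domain →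
    rP.domain = {z | e₁ < z 0 ∧ e₁ < z 1} →
    Set.EqOn rP.integrand
      (fun z => (Real.sqrt (f (z 0)))⁻¹ * ((g₂ * z 1 + 2 * g₃) / (2 * (z 1) ^ 2 * Real.sqrt (f (z 1))))) rP.domain →
    rW.domain = {t | e₁ < t 0} →
    Set.EqOn rW.integrand (fun t => ϱ / Real.sqrt (f (t 0))) rW.domain →
    ∃ (c : ℤ) (B : ℝ) (rB : Literature.NumberTheory.Transcendental.KZ.IntegralRep 1), 1 < B ∧ IsAlgebraic ℚ B ∧
    rB.domain = {t | 1 < t 0 ∧ t 0 < B} ∧ Set.EqOn rB.integrand (fun t => (t 0)⁻¹) rB.domain ∧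
    ((q : ℤ) ^ 2) • Literature.NumberTheory.Transcendental.KZ.of rI +
      ((p : ℤ) ^ 2) • Literature.NumberTheory.Transcendental.KZ.of rP +
      (2 * (q : ℤ) * p) • Literature.NumberTheory.Transcendental.KZ.of rW -
      c • Literature.NumberTheory.Transcendental.KZ.of rB ∈ Literature.NumberTheory.Transcendental.KZ.relations

/-- RUNG (verbatim copy). -/
def NeronTorsionTwoPoint : Prop := ∀ N' : ℕ, NeronTorsionChainFrom N'

/-- The rung contains every member, in particular the floor member `N' = 2`. -/
theorem neronTorsionChainFrom_of_twoPoint (h : NeronTorsionTwoPoint) (N' : ℕ) : NeronTorsionChainFrom N' := h N'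

/-- **FLOOR CASE (F3).** The member `N' = 2` of the family follows from the seed `stub_assembly`
(`NeronTorsionPrimitiveChain`): `a' = 1`, `x_Q = e₁`, `ϱ = 0` are forced and `[rW] ∈ relations`. -/
theorem neronTorsionChainFrom_two : NeronTorsionChainFrom 2 := by
  intro g₂ g₃ e₁ xP yP xQ yQ ϱ N a a' p q f hf hΔ he₁ he₁pos hfpos hxP hyP hN ha haN hordP hintP
    hxQ _hxQP _hyQ _hN' ha' ha'N' _hordQ hintQ hEtaQ hcop hpq rI rP rW hrId hrIi hrPd hrPi _hrWd hrWi
  -- the sheet condition at `N' = 2` forces `a' = 1`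
  obtain rfl : a' = 1 := by omega
  -- the first-kind datum forces `x_Q = e₁` (real dictionary: `u ↦ ∫_{X u}^∞ dx/√f` is the identity on `(0, ω/2]`)
  obtain ⟨ω, X, Y, _hω, hωint, -, -, -, -, -, -, -, -, -, -, hsurj, hint, -⟩ :=
    stub_realDictionary g₂ g₃ e₁ f hf hΔ he₁ hfpos
  have hxQe : xQ = e₁ := by
    by_contra hne
    obtain ⟨u, hu, hXu⟩ := hsurj xQ (lt_of_le_of_ne hxQ (Ne.symm hne))
    have h1 := hint u ⟨hu.1, hu.2.le⟩
    rw [hXu] at h1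
    have h2 : (2 : ℝ) * u = ω := by
      have h3 := hintQ
      push_cast at h3
      rw [h1] at h3
      linarith
    linarith [hu.2]
  -- the second-kind datum on the empty interval forces `ϱ = 0`
  have hϱ : ϱ = 0 := by
    rw [hxQe, Set.Ioo_self, Measure.restrict_empty, integral_zero_measure] at hEtaQ
    norm_num at hEtaQ
    linarith
  -- hence `[rW]` is a relation (its integrand vanishes on its domain)
  have hW : KZ.of rW ∈ KZ.relations :=
    KZ.of_mem_relations_of_eqOn_zero rW fun t ht => by
      rw [hrWi ht]
      simp [hϱ]
  -- the slope datum is the floor's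
  have hqN : (q : ℤ) * ((N : ℤ) - 2 * (a : ℤ)) = (p : ℤ) * (2 * (N : ℤ)) := by
    have h3 := hpq
    push_cast at h3
    linarith
  rw [hxQe] at hrId
  obtain ⟨c, B, rB, hB1, hBalg, hrBd, hrBi, hmem⟩ := stub_assembly g₂ g₃ e₁ xP yP N a p q f hf hΔ he₁
    he₁pos hfpos hxP hyP hN ha haN hordP hintP hcop hqN rI rP hrId hrIi hrPd hrPi
  refine ⟨c, B, rB, hB1, hBalg, hrBd, hrBi, ?_⟩
  have e : ((q : ℤ) ^ 2) • KZ.of rI + ((p : ℤ) ^ 2) • KZ.of rP + (2 * (q : ℤ) * p) • KZ.of rW - c • KZ.of rB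
      = (((q : ℤ) ^ 2) • KZ.of rI + ((p : ℤ) ^ 2) • KZ.of rP - c • KZ.of rB) + (2 * (q : ℤ) * p) • KZ.of rW := by
    abel
  rw [e]
  exact add_mem hmem (AddSubgroup.zsmul_mem _ hW _)

/-- The floor statement, verbatim (`Theses.TorsionLogs.NeronTorsionPrimitiveChain`). -/
example : Summit.KontsevichZagierPeriods.KontsevichZagierPeriods.Theses.TorsionLogs.NeronTorsionPrimitiveChain :=
  stub_assembly

/-- **Converse: the member `N' = 2` gives the floor back** (so the floor is LITERALLY the `N' = 2` member):
specialise to `Q = (e₁, 0)` (order `2`), `a' = 1`, `ϱ = 0`, `rW` = the zero representation on `{e₁ < t}`. -/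
theorem neronTorsionPrimitiveChain_of_two (h : NeronTorsionChainFrom 2) :
    Summit.KontsevichZagierPeriods.KontsevichZagierPeriods.Theses.TorsionLogs.NeronTorsionPrimitiveChain := by
  intro g₂ g₃ e₁ xP yP N a p q f hf hΔ he₁ he₁pos hfpos hxP hyP hN ha haN hordP hintP hcop hqN rI rP
    hrId hrIi hrPd hrPi
  -- `e₁` is algebraic (forced by `rI`), so the zero representation on `{e₁ < t}` exists
  obtain ⟨-, -, He₁, -⟩ := stub_parametersAlgebraic g₂ g₃ e₁ xP f hf he₁ he₁pos hfpos hxP rI rP hrId hrIi hrPd hrPi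
  have hU : IsSemialgebraic ℚ (univ : Set (Fin 1 → ℝ)) := isSemialgebraic_univ
  have hc : IsSemialgebraicFunOn ℚ (univ : Set (Fin 1 → ℝ)) (fun p => p 0) :=
    (isSemialgebraicFunOn_aeval hU (MvPolynomial.X 0)).congr fun p _ => by simp
  have hσ : IsSemialgebraic ℚ {t : Fin 1 → ℝ | e₁ < t 0} :=
    isSemialgebraic_setOf_lt_of_isSemialgebraicFunOn (isSemialgebraicFunOn_const_of_isAlgebraic hU He₁) hc
  obtain ⟨rW, hrWd, hrWi⟩ := KZ.exists_zeroRep hσ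
  have hW : KZ.of rW ∈ KZ.relations :=
    KZ.of_mem_relations_of_eqOn_zero rW fun t _ => by rw [hrWi]
  -- the 2-torsion point `(e₁, 0)` has order `2`
  have hord2 : ∀ hns : (⟨0, 0, 0, -g₂ / 4, -g₃ / 4⟩ : WeierstrassCurve ℝ).toAffine.Nonsingular e₁ ((0 : ℝ) / 2),
      addOrderOf (WeierstrassCurve.Affine.Point.some e₁ ((0 : ℝ) / 2) hns) = 2 := by
    intro hns
    refine addOrderOf_eq_prime ?_ (WeierstrassCurve.Affine.Point.some_ne_zero hns)
    rw [two_nsmul]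
    exact WeierstrassCurve.Affine.Point.add_self_of_Y_eq (by simp [WeierstrassCurve.Affine.negY])
  have hpq : ((q : ℕ) : ℤ) * (((1 : ℕ) : ℤ) * N - (a : ℤ) * ((2 : ℕ) : ℤ)) = (p : ℤ) * ((N : ℤ) * ((2 : ℕ) : ℤ)) := by
    push_cast
    linarith
  have hintQ : (((2 : ℕ) : ℕ) : ℝ) * (∫ x in Set.Ioi e₁, (Real.sqrt (f x))⁻¹)
      = ((1 : ℕ) : ℝ) * (2 * ∫ x in Set.Ioi e₁, (Real.sqrt (f x))⁻¹) := by
    push_cast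
    ring
  have hEtaQ : (∫ x in Set.Ioo e₁ e₁, x / Real.sqrt (f x)) =
      0 + (((1 : ℕ) : ℝ) / ((2 : ℕ) : ℕ) - 1 / 2) *
        ∫ x in Set.Ioi e₁, (g₂ * x + 2 * g₃) / (2 * x ^ 2 * Real.sqrt (f x)) := by
    rw [Set.Ioo_self, Measure.restrict_empty, integral_zero_measure]
    norm_num
  have hyQ : (0 : ℝ) ^ 2 = f e₁ := by rw [he₁]; ring
  obtain ⟨c, B, rB, hB1, hBalg, hrBd, hrBi, hmem⟩ := h g₂ g₃ e₁ xP yP e₁ 0 0 N a 1 p q f hf hΔ he₁ he₁pos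
    hfpos hxP hyP hN ha haN hordP hintP le_rfl hxP hyQ le_rfl one_pos le_rfl hord2 hintQ hEtaQ hcop hpq rI rP rW
    hrId hrIi hrPd hrPi hrWd (fun t _ => by simp [hrWi])
  refine ⟨c, B, rB, hB1, hBalg, hrBd, hrBi, ?_⟩
  have e : ((q : ℤ) ^ 2) • KZ.of rI + ((p : ℤ) ^ 2) • KZ.of rP - c • KZ.of rB
      = (((q : ℤ) ^ 2) • KZ.of rI + ((p : ℤ) ^ 2) • KZ.of rP + (2 * (q : ℤ) * p) • KZ.of rW - c • KZ.of rB)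
        - (2 * (q : ℤ) * p) • KZ.of rW := by
    abel
  rw [e]
  exact sub_mem hmem (AddSubgroup.zsmul_mem _ hW _)

/-- **The floor is literally the `N' = 2` member of the family.** -/
theorem neronTorsionChainFrom_two_iff :
    NeronTorsionChainFrom 2 ↔
      Summit.KontsevichZagierPeriods.KontsevichZagierPeriods.Theses.TorsionLogs.NeronTorsionPrimitiveChain :=
  ⟨neronTorsionPrimitiveChain_of_two, fun _ => neronTorsionChainFrom_two⟩

/-- The rung gives the floor. -/
theorem floor_of_rung (h : NeronTorsionTwoPoint) :
    Summit.KontsevichZagierPeriods.KontsevichZagierPeriods.Theses.TorsionLogs.NeronTorsionPrimitiveChain :=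
  neronTorsionPrimitiveChain_of_two (h 2)


/-! ### For the forward kernel: the rung / the member `N' = 2` give the floor's statement VERBATIM
(the type of `stub_assembly`, so that `rung → floor` is found without unfolding `NeronTorsionPrimitiveChain`). -/

/-- `NeronTorsionTwoPoint` implies the floor statement verbatim. -/
theorem stub_assembly_statement_of_rung (h : NeronTorsionTwoPoint) : ∀ (g₂ g₃ e₁ xP yP : ℝ) (N a p q : ℕ) (f : ℝ → ℝ),
    (∀ x, f x = 4 * x ^ 3 - g₂ * x - g₃) → g₂ ^ 3 - 27 * g₃ ^ 2 ≠ 0 → f e₁ = 0 → 0 < e₁ →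
    (∀ x, e₁ < x → 0 < f x) → e₁ < xP → yP ^ 2 = f xP → 3 ≤ N → 0 < a → 2 * a < N →
    (∀ hns : (⟨0, 0, 0, -g₂ / 4, -g₃ / 4⟩ : WeierstrassCurve ℝ).toAffine.Nonsingular xP (yP / 2),
    addOrderOf (WeierstrassCurve.Affine.Point.some xP (yP / 2) hns) = N) →
    (N : ℝ) * (∫ x in Set.Ioi xP, (Real.sqrt (f x))⁻¹) = a * (2 * ∫ x in Set.Ioi e₁, (Real.sqrt (f x))⁻¹) →
    Nat.Coprime p q → (q : ℤ) * ((N : ℤ) - 2 * (a : ℤ)) = (p : ℤ) * (2 * (N : ℤ)) →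
    ∀ (rI rP : Literature.NumberTheory.Transcendental.KZ.IntegralRep 2),
    rI.domain = {z | e₁ < z 1 ∧ z 1 < z 0 ∧ z 0 < xP} →
    Set.EqOn rI.integrand (fun z => z 1 / (Real.sqrt (f (z 1)) * Real.sqrt (f (z 0)))) rI.domain →
    rP.domain = {z | e₁ < z 0 ∧ e₁ < z 1} →
    Set.EqOn rP.integrand
    (fun z => (Real.sqrt (f (z 0)))⁻¹ * ((g₂ * z 1 + 2 * g₃) / (2 * (z 1) ^ 2 * Real.sqrt (f (z 1))))) rP.domain →
    ∃ (c : ℤ) (B : ℝ) (rB : Literature.NumberTheory.Transcendental.KZ.IntegralRep 1), 1 < B ∧ IsAlgebraic ℚ B ∧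
    rB.domain = {t | 1 < t 0 ∧ t 0 < B} ∧ Set.EqOn rB.integrand (fun t => (t 0)⁻¹) rB.domain ∧
    ((q : ℤ) ^ 2) • Literature.NumberTheory.Transcendental.KZ.of rI + ((p : ℤ) ^ 2) • Literature.NumberTheory.Transcendental.KZ.of rP - c • Literature.NumberTheory.Transcendental.KZ.of rB ∈ Literature.NumberTheory.Transcendental.KZ.relations :=
  floor_of_rung h

/-- The member `N' = 2` implies the floor statement verbatim. -/
theorem stub_assembly_statement_of_two (h : NeronTorsionChainFrom 2) : ∀ (g₂ g₃ e₁ xP yP : ℝ) (N a p q : ℕ) (f : ℝ → ℝ),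
    (∀ x, f x = 4 * x ^ 3 - g₂ * x - g₃) → g₂ ^ 3 - 27 * g₃ ^ 2 ≠ 0 → f e₁ = 0 → 0 < e₁ →
    (∀ x, e₁ < x → 0 < f x) → e₁ < xP → yP ^ 2 = f xP → 3 ≤ N → 0 < a → 2 * a < N →
    (∀ hns : (⟨0, 0, 0, -g₂ / 4, -g₃ / 4⟩ : WeierstrassCurve ℝ).toAffine.Nonsingular xP (yP / 2),
    addOrderOf (WeierstrassCurve.Affine.Point.some xP (yP / 2) hns) = N) →
    (N : ℝ) * (∫ x in Set.Ioi xP, (Real.sqrt (f x))⁻¹) = a * (2 * ∫ x in Set.Ioi e₁, (Real.sqrt (f x))⁻¹) →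
    Nat.Coprime p q → (q : ℤ) * ((N : ℤ) - 2 * (a : ℤ)) = (p : ℤ) * (2 * (N : ℤ)) →
    ∀ (rI rP : Literature.NumberTheory.Transcendental.KZ.IntegralRep 2),
    rI.domain = {z | e₁ < z 1 ∧ z 1 < z 0 ∧ z 0 < xP} →
    Set.EqOn rI.integrand (fun z => z 1 / (Real.sqrt (f (z 1)) * Real.sqrt (f (z 0)))) rI.domain →
    rP.domain = {z | e₁ < z 0 ∧ e₁ < z 1} →
    Set.EqOn rP.integrand
    (fun z => (Real.sqrt (f (z 0)))⁻¹ * ((g₂ * z 1 + 2 * g₃) / (2 * (z 1) ^ 2 * Real.sqrt (f (z 1))))) rP.domain →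
    ∃ (c : ℤ) (B : ℝ) (rB : Literature.NumberTheory.Transcendental.KZ.IntegralRep 1), 1 < B ∧ IsAlgebraic ℚ B ∧
    rB.domain = {t | 1 < t 0 ∧ t 0 < B} ∧ Set.EqOn rB.integrand (fun t => (t 0)⁻¹) rB.domain ∧
    ((q : ℤ) ^ 2) • Literature.NumberTheory.Transcendental.KZ.of rI + ((p : ℤ) ^ 2) • Literature.NumberTheory.Transcendental.KZ.of rP - c • Literature.NumberTheory.Transcendental.KZ.of rB ∈ Literature.NumberTheory.Transcendental.KZ.relations :=
  neronTorsionPrimitiveChain_of_two h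


end Summit.KontsevichZagierPeriods.KontsevichZagierPeriods.Cruxes.TorsionSectorComplete.NeronTorsionTwoPoint.Special
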